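import Literature.Probability.RandomPlanarGeometry.SAWTileConnectors
import Literature.Probability.RandomPlanarGeometry.SAWPolygonOpening
import HarnessLib

/-!
# Polygons of `P_m` placed in the inner box of a tile, opened at a port

H. Duminil-Copin, G. Kozma, A. Yadin, *Supercritical self-avoiding walks are space-filling*,
Ann. IHP Probab. Stat. 50 (2014), §3, place a polygon of `P_m` ("self-avoiding polygons in
`[0,2m+1]²` that touch the middle of every face", `facePolygons m`, partition function
`Z_m(x) = Zbox m x`) in every box of a connected family and open it at a cardinal edge to merge
it with its neighbours. Over the odd tiles of `SAWTiles.lean` (`OddTile.innerBox m r τ`, ports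
`OddTile.portA/portB m r τ d`): `OddTile.tilePolygons m r τ` is the set of translates of the
polygons of `P_m` into the inner box of tile `τ` (so `Σ_{E} x^{#E} = Z_m(x)`,
`OddTile.sum_tilePolygons`), each is a polygon of `ℤ²` inside the inner box containing the four
port edges `s(portA τ d, portB τ d)` (the translated cardinal edges), and
`OddTile.openAt m r τ d E` is its opening at the port facing `d` (`openList` of
`SAWPolygonOpening.lean`): a self-avoiding vertex list from `portA τ d` to `portB τ d` with `#E`
vertices, inside the inner box, in which the three other ports occur as consecutive pairs, and
which determines `E`.
-/

noncomputable section

open Finset Literature.Probability.LatticeModels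

namespace Literature.Probability.RandomPlanarGeometry.SAW

/-! ### Translations of `ℤ²` -/

/-- Translation by `c` as an automorphism of the nearest-neighbour graph `ℤ²` (cf.
`Percolation.zdShiftIso`, not in the import closure here). [folklore] -/
def translateIso (c : Site 2) : zdGraph 2 ≃g zdGraph 2 where
  toEquiv := Equiv.addRight c
  map_rel_iff' := zdGraph_adj_shift_iff c _ _

/-- `translateIso c x = x + c`. [folklore] -/
@[simp] theorem translateIso_apply (c x : Site 2) : translateIso c x = x + c := rfl

/-- Translation of unordered pairs of sites by `c`, an embedding. [folklore] -/
def shiftSym2 (c : Site 2) : Sym2 (Site 2) ↪ Sym2 (Site 2) :=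
  ⟨Sym2.map (· + c), Sym2.map.injective (add_left_injective c)⟩

/-- `shiftSym2 c s(a, b) = s(a + c, b + c)`. [folklore] -/
@[simp] theorem shiftSym2_mk (c a b : Site 2) : shiftSym2 c s(a, b) = s(a + c, b + c) := rfl

namespace OddTile

variable {m r : ℕ}

/-! ### The cardinal edges in box coordinates and the ports -/

variable (m) in
/-- First endpoint, in the coordinates of `[0, 2m+1]²`, of the cardinal edge on the side `d`:
`(2m+1, m)` (east), `(m, 2m+1)` (north), `(0, m)` (west), `(m, 0)` (south).
[cite: DuminilCopinKozmaYadin2014, §2 (definition of P_m)] -/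
def cardA : Dir → Site 2
  | .E => pt (2 * m + 1) m
  | .N => pt m (2 * m + 1)
  | .W => pt 0 m
  | .S => pt m 0

variable (m) in
/-- Second endpoint of the cardinal edge on the side `d`: `(2m+1, m+1)`, `(m+1, 2m+1)`,
`(0, m+1)`, `(m+1, 0)`. [cite: DuminilCopinKozmaYadin2014, §2 (definition of P_m)] -/
def cardB : Dir → Site 2
  | .E => pt (2 * m + 1) (m + 1)
  | .N => pt (m + 1) (2 * m + 1)
  | .W => pt 0 (m + 1)
  | .S => pt (m + 1) 0

/-- The four pairs `s(cardA d, cardB d)` are the four cardinal edges of `[0, 2m+1]²`.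
[cite: DuminilCopinKozmaYadin2014, §2 (definition of P_m)] -/
theorem cardinal_mem_cardinalEdges (d : Dir) : s(cardA m d, cardB m d) ∈ cardinalEdges m := by
  have hE : s(cardA m .E, cardB m .E) = s(![2 * (m : ℤ) + 1, m], ![2 * (m : ℤ) + 1, (m : ℤ) + 1]) := rfl
  have hN : s(cardA m .N, cardB m .N) = s(![(m : ℤ), 2 * (m : ℤ) + 1], ![(m : ℤ) + 1, 2 * (m : ℤ) + 1]) := rfl
  have hW : s(cardA m .W, cardB m .W) = s(![0, (m : ℤ)], ![0, (m : ℤ) + 1]) := rfl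
  have hS : s(cardA m .S, cardB m .S) = s(![(m : ℤ), 0], ![(m : ℤ) + 1, 0]) := rfl
  cases d <;> simp only [hE, hN, hW, hS, cardinalEdges, Finset.mem_insert, Finset.mem_singleton,
    true_or, or_true]

/-- The port endpoint `portA` is the translate of `cardA` by the inner corner.
[cite: DuminilCopinKozmaYadin2014, §3 (m-boxes)] -/
theorem portA_eq (τ : Site 2) (d : Dir) : portA m r τ d = cardA m d + innerCorner m r τ := by
  rw [site_eq_iff]
  cases d <;> simp only [portA, cardA, Pi.add_apply, pt_apply_zero, pt_apply_one,
    innerCorner_apply_zero, innerCorner_apply_one] <;> constructor <;> ring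

/-- The port endpoint `portB` is the translate of `cardB` by the inner corner.
[cite: DuminilCopinKozmaYadin2014, §3 (m-boxes)] -/
theorem portB_eq (τ : Site 2) (d : Dir) : portB m r τ d = cardB m d + innerCorner m r τ := by
  rw [site_eq_iff]
  cases d <;> simp only [portB, cardB, Pi.add_apply, pt_apply_zero, pt_apply_one,
    innerCorner_apply_zero, innerCorner_apply_one] <;> constructor <;> ring

/-- The port pairs of different sides are different edges. [folklore] -/
theorem port_pair_ne {τ : Site 2} {d d' : Dir} (h : d ≠ d') :
    s(portA m r τ d, portB m r τ d) ≠ s(portA m r τ d', portB m r τ d') := by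
  intro heq
  rw [Sym2.eq_iff, site_eq_iff, site_eq_iff, site_eq_iff, site_eq_iff] at heq
  cases d <;> cases d' <;> simp [portA, portB] at heq h <;> omega

/-! ### Polygons of `P_m` in the inner box of a tile -/

variable (m r) in
/-- The polygons of `P_m` translated into the inner box of tile `τ` (by `innerCorner m r τ`).
[cite: DuminilCopinKozmaYadin2014, §3 (a polygon of P_m in each box of F)] -/
def tilePolygons (τ : Site 2) : Finset (Finset (Sym2 (Site 2))) :=
  (facePolygons m).map (Finset.mapEmbedding (shiftSym2 (innerCorner m r τ))).toEmbedding

/-- Membership in `tilePolygons`: a translate of a polygon of `P_m`. [folklore] -/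
theorem mem_tilePolygons_iff {τ : Site 2} {E : Finset (Sym2 (Site 2))} :
    E ∈ tilePolygons m r τ ↔ ∃ E₀ ∈ facePolygons m, E₀.map (shiftSym2 (innerCorner m r τ)) = E := by
  simp [tilePolygons]

/-- **The partition function of a tile is `Z_m(x)`**: `Σ_{E ∈ tilePolygons τ} x^{#E} = Z_m(x)`
(translation preserves the number of edges). [cite: DuminilCopinKozmaYadin2014, §2 (definition of Z_m)] -/
theorem sum_tilePolygons (τ : Site 2) (x : ℝ) :
    ∑ E ∈ tilePolygons m r τ, x ^ E.card = Zbox m x := by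
  rw [tilePolygons, Finset.sum_map, Zbox]
  refine Finset.sum_congr rfl fun E₀ _ => ?_
  simp

/-- A tile polygon is a self-avoiding polygon of `ℤ²`. [cite: DuminilCopinKozmaYadin2014, §2 (definition of P_m)] -/
theorem isPolygon_of_mem_tilePolygons {τ : Site 2} {E : Finset (Sym2 (Site 2))}
    (hE : E ∈ tilePolygons m r τ) : IsPolygon (zdGraph 2) E := by
  classical
  obtain ⟨E₀, hE₀, rfl⟩ := mem_tilePolygons_iff.1 hE
  obtain ⟨-, ⟨u, c, hc, rfl⟩, -⟩ := mem_facePolygons_iff.1 hE₀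
  refine ⟨_, c.map (translateIso (innerCorner m r τ)).toHom, ?_, ?_⟩
  · exact hc.map (translateIso (innerCorner m r τ)).injective
  · ext e
    simp only [List.mem_toFinset, SimpleGraph.Walk.edges_map, List.mem_map, Finset.mem_map]
    constructor
    · rintro ⟨a, ha, rfl⟩; exact ⟨a, ha, rfl⟩
    · rintro ⟨a, ha, rfl⟩; exact ⟨a, ha, rfl⟩

/-- Every vertex of an edge of a tile polygon lies in the inner box of the tile.
[cite: DuminilCopinKozmaYadin2014, §2 (P_m ⊆ [0,2m+1]²)] -/
theorem mem_innerBox_of_mem_tilePolygons {τ : Site 2} {E : Finset (Sym2 (Site 2))}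
    (hE : E ∈ tilePolygons m r τ) {e : Sym2 (Site 2)} (he : e ∈ E) {v : Site 2} (hv : v ∈ e) :
    v ∈ innerBox m r τ := by
  obtain ⟨E₀, hE₀, rfl⟩ := mem_tilePolygons_iff.1 hE
  obtain ⟨hsub, -, -⟩ := mem_facePolygons_iff.1 hE₀
  rw [Finset.mem_map] at he
  obtain ⟨e₀, he₀, rfl⟩ := he
  have hin := hsub he₀
  rw [edgesIn, Finset.mem_filter, Finset.mem_sym2_iff] at hin
  induction e₀ using Sym2.ind with
  | _ a b =>
    rw [shiftSym2_mk, Sym2.mem_iff] at hv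
    rw [innerBox, Finset.mem_map]
    rcases hv with rfl | rfl
    · exact ⟨a, hin.2 a (Sym2.mem_mk_left _ _), rfl⟩
    · exact ⟨b, hin.2 b (Sym2.mem_mk_right _ _), rfl⟩

/-- A tile polygon contains the four port edges of the tile (the translated cardinal edges).
[cite: DuminilCopinKozmaYadin2014, §2 (P_m touches the middle of every face)] -/
theorem port_mem_of_mem_tilePolygons {τ : Site 2} {E : Finset (Sym2 (Site 2))}
    (hE : E ∈ tilePolygons m r τ) (d : Dir) : s(portA m r τ d, portB m r τ d) ∈ E := by
  obtain ⟨E₀, hE₀, rfl⟩ := mem_tilePolygons_iff.1 hE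
  obtain ⟨-, -, hcard⟩ := mem_facePolygons_iff.1 hE₀
  rw [portA_eq, portB_eq, ← shiftSym2_mk]
  exact Finset.mem_map_of_mem _ (hcard (cardinal_mem_cardinalEdges d))

/-! ### Opening a tile polygon at a port -/

variable (m r) in
/-- The opening of the tile polygon `E` at the port facing `d`: a self-avoiding vertex list from
`portA τ d` to `portB τ d` tracing the other edges of `E` ("removing `[a,b]` from `P_B`").
[cite: DuminilCopinKozmaYadin2014, §3 (proof of Proposition 7)] -/
def openAt (τ : Site 2) (d : Dir) (E : Finset (Sym2 (Site 2))) : List (Site 2) :=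
  openList (zdGraph 2) E (portA m r τ d) (portB m r τ d)

/-- The opening of a tile polygon: a self-avoiding chain from `portA` to `portB` with `#E ≥ 3`
vertices whose consecutive pairs are `E ∖ {port edge}`. [cite: DuminilCopinKozmaYadin2014, §3 (proof of Proposition 7)] -/
theorem openAt_spec {τ : Site 2} {d : Dir} {E : Finset (Sym2 (Site 2))} (hE : E ∈ tilePolygons m r τ) :
    (openAt m r τ d E).IsChain (zdGraph 2).Adj ∧ (openAt m r τ d E).Nodup ∧
      (openAt m r τ d E).head? = some (portA m r τ d) ∧
      (openAt m r τ d E).getLast? = some (portB m r τ d) ∧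
      (openAt m r τ d E).length = E.card ∧ 3 ≤ E.card ∧
      (pairEdges (openAt m r τ d E)).toFinset = E.erase s(portA m r τ d, portB m r τ d) ∧
      s(portA m r τ d, portB m r τ d) ∉ pairEdges (openAt m r τ d E) :=
  openList_spec (isPolygon_of_mem_tilePolygons hE) (port_mem_of_mem_tilePolygons hE d)

/-- The opening is non-empty. [folklore] -/
theorem openAt_ne_nil {τ : Site 2} {d : Dir} {E : Finset (Sym2 (Site 2))}
    (hE : E ∈ tilePolygons m r τ) : openAt m r τ d E ≠ [] := by
  intro h
  have := (openAt_spec (d := d) hE).2.2.2.2.1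
  rw [h, List.length_nil] at this
  have := (openAt_spec (d := d) hE).2.2.2.2.2.1
  omega

/-- The opening stays in the inner box of the tile. [cite: DuminilCopinKozmaYadin2014, §2 (P_m ⊆ [0,2m+1]²)] -/
theorem mem_innerBox_of_mem_openAt {τ : Site 2} {d : Dir} {E : Finset (Sym2 (Site 2))}
    (hE : E ∈ tilePolygons m r τ) {v : Site 2} (hv : v ∈ openAt m r τ d E) : v ∈ innerBox m r τ := by
  obtain ⟨e, he, hve⟩ := exists_mem_of_mem_openList (isPolygon_of_mem_tilePolygons hE)
    (port_mem_of_mem_tilePolygons hE d) hv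
  exact mem_innerBox_of_mem_tilePolygons hE he hve

/-- The opening stays in the tile. [folklore] -/
theorem mem_tile_of_mem_openAt {τ : Site 2} {d : Dir} {E : Finset (Sym2 (Site 2))}
    (hE : E ∈ tilePolygons m r τ) {v : Site 2} (hv : v ∈ openAt m r τ d E) : v ∈ tile m r τ :=
  innerBox_subset_tile τ (mem_innerBox_of_mem_openAt hE hv)

/-- The other three ports occur as consecutive pairs of the opening.
[cite: DuminilCopinKozmaYadin2014, §3 (the merged polygon visits all external cardinal edges)] -/
theorem port_infix_openAt {τ : Site 2} {d d' : Dir} {E : Finset (Sym2 (Site 2))}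
    (hE : E ∈ tilePolygons m r τ) (hd : d' ≠ d) :
    [portA m r τ d', portB m r τ d'] <:+: openAt m r τ d E ∨
      [portB m r τ d', portA m r τ d'] <:+: openAt m r τ d E :=
  infix_openList_of_mem (isPolygon_of_mem_tilePolygons hE) (port_mem_of_mem_tilePolygons hE d)
    (port_mem_of_mem_tilePolygons hE d') (port_pair_ne hd)

/-- The opening determines the polygon. [folklore] -/
theorem eq_of_openAt_eq {τ : Site 2} {d : Dir} {E E' : Finset (Sym2 (Site 2))}
    (hE : E ∈ tilePolygons m r τ) (hE' : E' ∈ tilePolygons m r τ)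
    (h : openAt m r τ d E = openAt m r τ d E') : E = E' :=
  eq_of_openList_eq (isPolygon_of_mem_tilePolygons hE) (isPolygon_of_mem_tilePolygons hE')
    (port_mem_of_mem_tilePolygons hE d) (port_mem_of_mem_tilePolygons hE' d) h

end OddTile

end Literature.Probability.RandomPlanarGeometry.SAW
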